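import Summits.AnomalousDissipation.AnomalousDissipation.Theorems.SolenoidalFractalHomogenisationLagrangianStepLossCurrencyComparability
import HarnessLib

/-!
# K1L_D (stmt-AnomalousDissipation-27980): loss currency — CHANGE OF THE REFERENCE MEMBER and block bookkeeping
(helper; `--supports 27980 --as helper`; prover ad-sawtooth-k1loc-p1 g14; memo `K1loc-memo-v19-Vmod-cut` §2 (n5)/(n1); generic real Hilbert space,
companion of `…LossCurrency` (p690895) / `…LossCurrencyComparability`.)

* `lossBound_of_lossBound_ref` — if `(U, T₁)` satisfies the loss-currency bound with constant `η` (losses of `T₁`) and the two reference members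
  satisfy it against each other with constant `ε` (losses of `T₂`), then `(U, T₂)` satisfies it with constant `η(1 + 2ε) + ε` (losses of `T₂`):
  triangle inequality + the two comparabilities `q_{T₁} ≤ (1+2ε) q_{T₂}`, `q*_{T₁} ≤ (1+2ε) q*_{T₂}` (`loss_le_of_lossBound`, `lossAdj_le_of_lossBound`).
  Use: swap the coarse member of a certified pair for a form-close one (the (V_mod) route of the memo, stage ℓ3, and any re-centring of `Φ`).
* `lossBound_mono` — the bound is monotone in the constant.
* `lossBound_add_blocks` — two-block bookkeeping: if `x = x₁ + x₂`, `ζ = ζ₁ + ζ₂` and the four cross bounds hold with constants `ηᵢⱼ` against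
  nonnegative weights `aᵢ, bⱼ` with `a₁² + a₂² ≤ A²`, `b₁² + b₂² ≤ B²`, then the total is bounded by `(η₁₁ + η₁₂ + η₂₁ + η₂₂)·A·B` (crude
  Frobenius-type assembly; the (V_mod) flat stage feeds `aᵢ = √q_T(xᵢ)` for a block-diagonal reference `T`).
Pure algebra; nothing about the crux or AD is proved here (rung F-D1.A0).
-/

set_option linter.dupNamespace false  -- the summit-side namespace repeats `AnomalousDissipation` by design (D-0017)

noncomputable section

namespace Summit.AnomalousDissipation.AnomalousDissipation.Theorems.SolenoidalFractalHomogenisation.LagrangianStep.LossCurrency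

open scoped InnerProductSpace

variable {H : Type*} [NormedAddCommGroup H] [InnerProductSpace ℝ H] [CompleteSpace H]

/-- **Change of reference in loss currency**: `(U,T₁)` at constant `η` (losses of `T₁`) and `(T₁,T₂)` at constant `ε` (losses of `T₂`,
`T₂` a contraction) give `(U,T₂)` at constant `η(1+2ε) + ε` (losses of `T₂`). [folklore] -/
theorem lossBound_of_lossBound_ref {U T₁ T₂ : H →L[ℝ] H} {η ε : ℝ} (hη : 0 ≤ η) (hε : 0 ≤ ε)
    (hT₂ : ∀ y, ‖T₂ y‖ ≤ ‖y‖)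
    (h₁ : ∀ x ζ : H, |⟪U x - T₁ x, ζ⟫_ℝ|
      ≤ η * Real.sqrt (‖x‖ ^ 2 - ‖T₁ x‖ ^ 2) * Real.sqrt (‖ζ‖ ^ 2 - ‖ContinuousLinearMap.adjoint T₁ ζ‖ ^ 2))
    (h₁₂ : ∀ x ζ : H, |⟪T₁ x - T₂ x, ζ⟫_ℝ|
      ≤ ε * Real.sqrt (‖x‖ ^ 2 - ‖T₂ x‖ ^ 2) * Real.sqrt (‖ζ‖ ^ 2 - ‖ContinuousLinearMap.adjoint T₂ ζ‖ ^ 2))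
    (x ζ : H) :
    |⟪U x - T₂ x, ζ⟫_ℝ|
      ≤ (η * (1 + 2 * ε) + ε) * Real.sqrt (‖x‖ ^ 2 - ‖T₂ x‖ ^ 2) * Real.sqrt (‖ζ‖ ^ 2 - ‖ContinuousLinearMap.adjoint T₂ ζ‖ ^ 2) := by
  set q₂ : ℝ := ‖x‖ ^ 2 - ‖T₂ x‖ ^ 2 with hq₂
  set qs₂ : ℝ := ‖ζ‖ ^ 2 - ‖ContinuousLinearMap.adjoint T₂ ζ‖ ^ 2 with hqs₂
  -- comparabilities of the `T₁`-losses against the `T₂`-losses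
  have hcq : ‖x‖ ^ 2 - ‖T₁ x‖ ^ 2 ≤ (1 + 2 * ε) * q₂ := loss_le_of_lossBound hε hT₂ h₁₂ x
  have hcqs : ‖ζ‖ ^ 2 - ‖ContinuousLinearMap.adjoint T₁ ζ‖ ^ 2 ≤ (1 + 2 * ε) * qs₂ := lossAdj_le_of_lossBound hε hT₂ h₁₂ ζ
  have hs1 : Real.sqrt (‖x‖ ^ 2 - ‖T₁ x‖ ^ 2) ≤ Real.sqrt (1 + 2 * ε) * Real.sqrt q₂ := by
    rw [← Real.sqrt_mul (by linarith)]; exact Real.sqrt_le_sqrt hcq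
  have hs2 : Real.sqrt (‖ζ‖ ^ 2 - ‖ContinuousLinearMap.adjoint T₁ ζ‖ ^ 2) ≤ Real.sqrt (1 + 2 * ε) * Real.sqrt qs₂ := by
    rw [← Real.sqrt_mul (by linarith)]; exact Real.sqrt_le_sqrt hcqs
  -- triangle
  have hsplit : U x - T₂ x = (U x - T₁ x) + (T₁ x - T₂ x) := by abel
  have htri : |⟪U x - T₂ x, ζ⟫_ℝ| ≤ |⟪U x - T₁ x, ζ⟫_ℝ| + |⟪T₁ x - T₂ x, ζ⟫_ℝ| := by
    rw [hsplit, inner_add_left]; exact abs_add_le _ _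
  have hA : |⟪U x - T₁ x, ζ⟫_ℝ| ≤ η * (Real.sqrt (1 + 2 * ε) * Real.sqrt q₂) * (Real.sqrt (1 + 2 * ε) * Real.sqrt qs₂) := by
    refine (h₁ x ζ).trans ?_
    exact mul_le_mul (mul_le_mul_of_nonneg_left hs1 hη) hs2 (Real.sqrt_nonneg _)
      (mul_nonneg hη (mul_nonneg (Real.sqrt_nonneg _) (Real.sqrt_nonneg _)))
  have hsq : Real.sqrt (1 + 2 * ε) * Real.sqrt (1 + 2 * ε) = 1 + 2 * ε := Real.mul_self_sqrt (by linarith)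
  have hA' : |⟪U x - T₁ x, ζ⟫_ℝ| ≤ η * (1 + 2 * ε) * Real.sqrt q₂ * Real.sqrt qs₂ := by
    calc |⟪U x - T₁ x, ζ⟫_ℝ| ≤ η * (Real.sqrt (1 + 2 * ε) * Real.sqrt q₂) * (Real.sqrt (1 + 2 * ε) * Real.sqrt qs₂) := hA
      _ = η * (Real.sqrt (1 + 2 * ε) * Real.sqrt (1 + 2 * ε)) * Real.sqrt q₂ * Real.sqrt qs₂ := by ring
      _ = η * (1 + 2 * ε) * Real.sqrt q₂ * Real.sqrt qs₂ := by rw [hsq]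
  calc |⟪U x - T₂ x, ζ⟫_ℝ| ≤ |⟪U x - T₁ x, ζ⟫_ℝ| + |⟪T₁ x - T₂ x, ζ⟫_ℝ| := htri
    _ ≤ η * (1 + 2 * ε) * Real.sqrt q₂ * Real.sqrt qs₂ + ε * Real.sqrt q₂ * Real.sqrt qs₂ := add_le_add hA' (h₁₂ x ζ)
    _ = (η * (1 + 2 * ε) + ε) * Real.sqrt q₂ * Real.sqrt qs₂ := by ring

omit [CompleteSpace H] in
/-- The loss-currency bound is monotone in its constant (any nonnegative weights). [folklore] -/
theorem lossBound_mono {v : H} {ζ : H} {η η' a b : ℝ} (hηη' : η ≤ η') (ha : 0 ≤ a) (hb : 0 ≤ b)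
    (h : |⟪v, ζ⟫_ℝ| ≤ η * a * b) : |⟪v, ζ⟫_ℝ| ≤ η' * a * b :=
  h.trans (mul_le_mul_of_nonneg_right (mul_le_mul_of_nonneg_right hηη' ha) hb)

omit [CompleteSpace H] in
/-- **Two-block bookkeeping.**  With `v₁ + v₂` against `ζ₁ + ζ₂`, four cross bounds `|⟪vᵢ, ζⱼ⟫| ≤ ηᵢⱼ aᵢ bⱼ` against nonnegative weights with
`a₁² + a₂² ≤ A²`, `b₁² + b₂² ≤ B²` (`A, B ≥ 0`) give `|⟪v₁ + v₂, ζ₁ + ζ₂⟫| ≤ (η₁₁ + η₁₂ + η₂₁ + η₂₂)·A·B`. [folklore] -/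
theorem lossBound_add_blocks {v₁ v₂ ζ₁ ζ₂ : H} {η₁₁ η₁₂ η₂₁ η₂₂ a₁ a₂ b₁ b₂ A B : ℝ}
    (h₁₁ : |⟪v₁, ζ₁⟫_ℝ| ≤ η₁₁ * a₁ * b₁) (h₁₂ : |⟪v₁, ζ₂⟫_ℝ| ≤ η₁₂ * a₁ * b₂)
    (h₂₁ : |⟪v₂, ζ₁⟫_ℝ| ≤ η₂₁ * a₂ * b₁) (h₂₂ : |⟪v₂, ζ₂⟫_ℝ| ≤ η₂₂ * a₂ * b₂)
    (hη₁₁ : 0 ≤ η₁₁) (hη₁₂ : 0 ≤ η₁₂) (hη₂₁ : 0 ≤ η₂₁) (hη₂₂ : 0 ≤ η₂₂)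
    (hb₁ : 0 ≤ b₁) (hb₂ : 0 ≤ b₂) (hA : 0 ≤ A) (hB : 0 ≤ B)
    (haA : a₁ ^ 2 + a₂ ^ 2 ≤ A ^ 2) (hbB : b₁ ^ 2 + b₂ ^ 2 ≤ B ^ 2) :
    |⟪v₁ + v₂, ζ₁ + ζ₂⟫_ℝ| ≤ (η₁₁ + η₁₂ + η₂₁ + η₂₂) * A * B := by
  have ha₁A : a₁ ≤ A := by nlinarith [sq_nonneg a₂]
  have ha₂A : a₂ ≤ A := by nlinarith [sq_nonneg a₁]
  have hb₁B : b₁ ≤ B := by nlinarith [sq_nonneg b₂]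
  have hb₂B : b₂ ≤ B := by nlinarith [sq_nonneg b₁]
  have e : ⟪v₁ + v₂, ζ₁ + ζ₂⟫_ℝ = ⟪v₁, ζ₁⟫_ℝ + ⟪v₁, ζ₂⟫_ℝ + (⟪v₂, ζ₁⟫_ℝ + ⟪v₂, ζ₂⟫_ℝ) := by
    rw [inner_add_left, inner_add_right, inner_add_right]
  have k₁₁ : |⟪v₁, ζ₁⟫_ℝ| ≤ η₁₁ * A * B :=
    h₁₁.trans (mul_le_mul (mul_le_mul_of_nonneg_left ha₁A hη₁₁) hb₁B hb₁ (mul_nonneg hη₁₁ hA))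
  have k₁₂ : |⟪v₁, ζ₂⟫_ℝ| ≤ η₁₂ * A * B :=
    h₁₂.trans (mul_le_mul (mul_le_mul_of_nonneg_left ha₁A hη₁₂) hb₂B hb₂ (mul_nonneg hη₁₂ hA))
  have k₂₁ : |⟪v₂, ζ₁⟫_ℝ| ≤ η₂₁ * A * B :=
    h₂₁.trans (mul_le_mul (mul_le_mul_of_nonneg_left ha₂A hη₂₁) hb₁B hb₁ (mul_nonneg hη₂₁ hA))
  have k₂₂ : |⟪v₂, ζ₂⟫_ℝ| ≤ η₂₂ * A * B :=
    h₂₂.trans (mul_le_mul (mul_le_mul_of_nonneg_left ha₂A hη₂₂) hb₂B hb₂ (mul_nonneg hη₂₂ hA))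
  rw [e]
  calc |⟪v₁, ζ₁⟫_ℝ + ⟪v₁, ζ₂⟫_ℝ + (⟪v₂, ζ₁⟫_ℝ + ⟪v₂, ζ₂⟫_ℝ)|
      ≤ |⟪v₁, ζ₁⟫_ℝ + ⟪v₁, ζ₂⟫_ℝ| + |⟪v₂, ζ₁⟫_ℝ + ⟪v₂, ζ₂⟫_ℝ| := abs_add_le _ _
    _ ≤ (|⟪v₁, ζ₁⟫_ℝ| + |⟪v₁, ζ₂⟫_ℝ|) + (|⟪v₂, ζ₁⟫_ℝ| + |⟪v₂, ζ₂⟫_ℝ|) := add_le_add (abs_add_le _ _) (abs_add_le _ _)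
    _ ≤ (η₁₁ * A * B + η₁₂ * A * B) + (η₂₁ * A * B + η₂₂ * A * B) := add_le_add (add_le_add k₁₁ k₁₂) (add_le_add k₂₁ k₂₂)
    _ = (η₁₁ + η₁₂ + η₂₁ + η₂₂) * A * B := by ring

omit [CompleteSpace H] in
/-- Losses add over an orthogonal pair that the reference keeps orthogonal: if `⟪x₁, x₂⟫ = 0` and `⟪T x₁, T x₂⟫ = 0` then
`q_T(x₁ + x₂) = q_T(x₁) + q_T(x₂)`. [folklore] -/
theorem loss_add_of_orthogonal {T : H →L[ℝ] H} {x₁ x₂ : H} (h : ⟪x₁, x₂⟫_ℝ = 0) (hT : ⟪T x₁, T x₂⟫_ℝ = 0) :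
    ‖x₁ + x₂‖ ^ 2 - ‖T (x₁ + x₂)‖ ^ 2 = (‖x₁‖ ^ 2 - ‖T x₁‖ ^ 2) + (‖x₂‖ ^ 2 - ‖T x₂‖ ^ 2) := by
  have h1 : ‖x₁ + x₂‖ * ‖x₁ + x₂‖ = ‖x₁‖ * ‖x₁‖ + ‖x₂‖ * ‖x₂‖ := norm_add_sq_eq_norm_sq_add_norm_sq_of_inner_eq_zero _ _ h
  have h2 : ‖T x₁ + T x₂‖ * ‖T x₁ + T x₂‖ = ‖T x₁‖ * ‖T x₁‖ + ‖T x₂‖ * ‖T x₂‖ :=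
    norm_add_sq_eq_norm_sq_add_norm_sq_of_inner_eq_zero _ _ hT
  rw [map_add]
  nlinarith [h1, h2]

end Summit.AnomalousDissipation.AnomalousDissipation.Theorems.SolenoidalFractalHomogenisation.LagrangianStep.LossCurrency

end
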